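import Literature.IUT.HodgeArakelov.ThetaSettingHextReductionAtModelTate
import Literature.AnabelianGeometry.EtaleTheta.SettingModelGfpSlim
import HarnessLib

/-!
# The extension property `hextΔ` at the stage-2 Tate model: the GEOMETRIC CORE of the reduction —
# clause (ii) (twisted Tate-equivariance) is REDUNDANT too, and the geometric witness is UNIQUE (proof-only)

S. Mochizuki, *The étale theta function and its Frobenioid-theoretic manifestations* [EtTh], Publ. RIMS **45** (2009)
(refereed), §2, Prop. 2.4 p. 38 (every automorphism of `Π^tp_{X̲̲}` arises from one of `Π^tp_X`)
[cite: MochizukiEtTh2009, Prop 2.4 p.38]; §1 p. 12 (`Π^tp_X`, `Δ^tp_X`); Def. 2.5 (i) p. 39 (`X̲̲`); [SemiAnbd] Ex. 3.10 p. 45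
(«temp-slim»).

Cell `abc-iut`, seat abc-iut-L6-t13 (gen 13; K-L6 row «HEXT-DECIDE@modelχq», self-named sub-row «HEXT-GEOMETRIC-CORE»).
PROOF-ONLY companion of abc-iut-w5-d169's reduction of record `ThetaSettingHextReductionAtModelTate` (p497819 / v2 p498683,
★ `hext_at_iff_exists_gfpAut'`) and of abc-iut-w5-d111's `SettingModelGfpSlim` (`isSlimGroup_gfp`): NO definition, NO instance,
NO new named fact; every input is consumed BY NAME.

THE BINDER (displayed by p490266 / p491246 / p492265 / p493130 / p490639):
  `hextΔ(γ) : ∃ Γ : Π^tp_X ≃ₜ* Π^tp_X, Γ|_{Π^tp_{X̲̲}} = γ ∧ Γ(Δ^tp_X) = Δ^tp_X`     (`γ : Π^tp_{X̲̲} ≃ₜ* Π^tp_{X̲̲}`)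
at an `X̲̲`-choice `C` over `modelχq p i j` (`Π^tp_X = Γ ⋊_{actχq} G_{ℚ_p}`, `Γ = F̂₂ ×_Ẑ ℤ = Gfp`, `Δ^tp_X = inl Γ`) whose
`Π^tp_{X̲̲} = C.Huu` is the carrier of record `dUU l ⋊ G_{ℚ_p}` (membership clauses `hinl`/`hinr`/`hleft`, as in p497819).

THE REDUCTION OF RECORD (p498683 `hext_at_iff_exists_gfpAut'`): `hextΔ(γ) ⟺ ∃ Φ : Γ ≃ₜ* Γ` with
  (i)  `inl (Φ d) = γ (inl d)` on `dUU l`, and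
  (ii) `inl (Φ (σ·g)) = γ(inr σ) · inl (Φ g) · γ(inr σ)⁻¹` for all `σ ∈ G_{ℚ_p}`, `g ∈ Γ`.

WHAT THIS FILE PROVES (numbers, not adjectives; EVERY prime `p`, EVERY `i j`, EVERY `X̲̲`-choice of the displayed shape).
* §1 `monoidHom_apply_eq_of_eqOn_dUU` — **RIGIDITY ALONG THE OPEN SUBGROUP `dUU l`**: an OPEN endomorphism `A` of `Γ` (e.g. a
  topological automorphism) and ANY endomorphism `B` of `Γ` that agree on `dUU l` agree everywhere.  Proof: for `g ∈ Γ` the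
  element `(A g)⁻¹ · B g` centralises `A(dUU l ⊓ g·(dUU l)·g⁻¹)`, an OPEN subgroup, hence is trivial by `isSlimGroup_gfp`
  ([SemiAnbd] Ex. 3.10: `Γ` is temp-slim).  No level arithmetic, no parity, no `N` odd.
* §2 ★ `hext_at_iff_exists_gfpAut_extends` — **CLAUSE (ii) IS REDUNDANT**: `hextΔ(γ) ⟺ ∃ Φ : Γ ≃ₜ* Γ, (i)`.  Given (i), both
  `g ↦ Φ(σ·g)` and `g ↦ n_σ · (τ_σ·Φ g) · n_σ⁻¹` (where `γ(inr σ) = inl n_σ · inr τ_σ`) are endomorphisms of `Γ`, the first one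
  open, and they AGREE ON `dUU l` because `γ` is a homomorphism on `Π^tp_{X̲̲} ∋ inr σ · inl d · inr σ⁻¹ = inl (σ·d)`; §1 applies.
  So `hextΔ(γ)` is EXACTLY: «the geometric part `d ↦ γ(inl d)` of `γ` is the restriction of a bi-continuous automorphism of
  `Γ`» — the Galois section, the cocycle `n_σ` and the automorphism `τ` of `G_{ℚ_p}` induced by `γ` impose NO further condition.
  `hext_at_iff_exists_gfpAut_extends_of_eq` is the same at the carrier of record `Huuχq p i j l hl`.
* §3 `gfpAut_extends_unique` — the witness `Φ` of (i) is UNIQUE (§1 with `A := Φ₁`, `B := Φ₂`); `hext_extension_unique` — hence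
  the `Δ^tp_X`-stabilising extension `Γ ⊇ γ` of `hextΔ(γ)`, when it exists, is unique (`Γ x = inl (Φ x.left) · γ (inr x.right)`).
CONSEQUENCE FOR THE K-L6 CELL (honest words): with p498683 the question «`hextΔ` UNDECIDED-AT-MODEL» is now ONE statement about
the pair `dUU l ≤ Γ` ALONE: does every bi-continuous automorphism `γ` of `dUU l ⋊ G_{ℚ_p}` restrict on `inl (dUU l)` to (the
restriction of) an element of `Aut_top(Γ)`?  Instruments of record unchanged (R5-1 p496682/p497023: such a restriction preserves
every `Ker ĥ_N ∩ dUU l`, `N` odd; (K1) p496371; R5-2 3-adic certificate; XTHETA-KER).  Neither direction of `hextΔ` is claimed.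

HONEST LABEL. `modelχq` is a SEMI-SYNTHETIC model of the typed [EtTh] §1 interface (not the tempered `π₁` of a curve): a
statement about OUR model and OUR typed binder only; nothing of [EtTh] / [IUTchII] (claim key `Mochizuki2012`, DISPUTED, D-0012)
is asserted; no side is taken on [IUTchIII] Cor. 3.12; typed ≠ proved; nothing here bears on whether abc is proved or refuted.
bears_on: LADDER-ABC:A2.L-K (K-L6 «HEXT-DECIDE@modelχq») → LADDER-FRONTIER F-A2 (M·L6) → rung 0 `Summit.ABC`.
-/

set_option autoImplicit false

noncomputable section

namespace Literature.AnabelianGeometry.EtaleTheta.SettingModel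

open Literature.AnabelianGeometry.SemiGraphs
open Literature.IUT.HodgeArakelov Literature.IUT.HodgeArakelov.EtaleThetaDataOfSetting
open Function
open _root_.Topology

/-! ## §1. Rigidity along the open subgroup `dUU l` (`Γ` is slim) -/

/-- **Two endomorphisms of `Γ = F̂₂ ×_Ẑ ℤ` that agree on the open subgroup `dUU l` agree everywhere, provided the first is an
open map** (e.g. a topological automorphism): `(A g)⁻¹ · B g` centralises the open subgroup `A(dUU l ⊓ g(dUU l)g⁻¹)`, and `Γ` is
slim ([SemiAnbd] Ex. 3.10 p. 45, at the model: `isSlimGroup_gfp`). [cite: MochizukiSemiAnbd2006, Ex 3.10 p.45] -/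
theorem monoidHom_apply_eq_of_eqOn_dUU (l' : ℕ+) {A B : Gfp →* Gfp} (hA : IsOpenMap A)
    (h : ∀ d ∈ dUU l', A d = B d) (g : Gfp) : A g = B g := by
  -- the open subgroup `W = dUU l ⊓ g (dUU l) g⁻¹`... written as `{w ∈ dUU l | g w g⁻¹ ∈ dUU l}`
  let W : Subgroup Gfp := dUU l' ⊓ (dUU l').comap (MulAut.conj g).toMonoidHom
  have hWcoe : (W : Set Gfp) = (dUU l' : Set Gfp) ∩ (fun x => g * x * g⁻¹) ⁻¹' (dUU l' : Set Gfp) := rfl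
  have hconj : Continuous fun x : Gfp => g * x * g⁻¹ := (continuous_const.mul continuous_id).mul continuous_const
  have hW : IsOpen (W : Set Gfp) := by
    rw [hWcoe]
    exact (isOpen_dUU l').inter ((isOpen_dUU l').preimage hconj)
  have hAW : IsOpen ((W.map A : Subgroup Gfp) : Set Gfp) := by
    rw [Subgroup.coe_map]
    exact hA _ hW
  have hcent := (isSlimGroup_gfp).centralizer_eq_bot (W.map A) hAW
  have key : (A g)⁻¹ * B g ∈ Subgroup.centralizer ((W.map A : Subgroup Gfp) : Set Gfp) := by
    rw [Subgroup.mem_centralizer_iff]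
    rintro _ ⟨w, hw, rfl⟩
    have hw1 : w ∈ dUU l' := (Subgroup.mem_inf.mp hw).1
    have hw2 : g * w * g⁻¹ ∈ dUU l' := (Subgroup.mem_inf.mp hw).2
    have e1 : B g * B w * (B g)⁻¹ = A g * A w * (A g)⁻¹ := by
      have := (h _ hw2).symm
      simpa only [map_mul, map_inv] using this
    rw [← h _ hw1] at e1
    change A w * ((A g)⁻¹ * B g) = (A g)⁻¹ * B g * A w
    calc A w * ((A g)⁻¹ * B g) = (A g)⁻¹ * (A g * A w * (A g)⁻¹) * B g := by group
      _ = (A g)⁻¹ * (B g * A w * (B g)⁻¹) * B g := by rw [e1]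
      _ = (A g)⁻¹ * B g * A w := by group
  rw [hcent, Subgroup.mem_bot] at key
  exact (inv_mul_eq_one.mp key)

/-- Each `actχq σ` is an OPEN map of `Γ` (a homeomorphism with inverse `actχq σ⁻¹`). [cite: MochizukiEtTh2009, §1 p.13] -/
theorem isOpenMap_actχq (p : ℕ) [Fact p.Prime] (i j : ℤ) (σ : GQp p) : IsOpenMap (actχq p i j σ : Gfp → Gfp) := by
  let e : Gfp ≃ₜ Gfp :=
    { toFun := actχq p i j σ
      invFun := actχq p i j σ⁻¹
      left_inv := fun x => by
        change (actχq p i j σ⁻¹ * actχq p i j σ) x = x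
        rw [← map_mul, inv_mul_cancel, map_one, MulAut.one_apply]
      right_inv := fun x => by
        change (actχq p i j σ * actχq p i j σ⁻¹) x = x
        rw [← map_mul, mul_inv_cancel, map_one, MulAut.one_apply]
      continuous_toFun := continuous_actχq_apply p i j σ
      continuous_invFun := continuous_actχq_apply p i j σ⁻¹ }
  exact e.isOpenMap

variable {p : ℕ} [Fact p.Prime] {i j : ℤ} {hj : Even j} {E : (ThetaSetting.modelχq p i j hj).EtaleThetaData} {l : ℕ}
  (C : E.DoubleUnderline l) {l' : ℕ+}
  (hinl : ∀ d ∈ dUU l', (SemidirectProduct.inl d : PiTpχq p i j) ∈ C.Huu)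
  (hinr : ∀ σ : GQp p, (SemidirectProduct.inr σ : PiTpχq p i j) ∈ C.Huu)
  (hleft : ∀ h ∈ C.Huu, (h : PiTpχq p i j).left ∈ dUU l')

/-! ## §2. Clause (ii) is redundant: `hextΔ(γ) ⟺ ∃ Φ : Γ ≃ₜ* Γ` extending the geometric part of `γ` -/

include hinl hinr hleft in
/-- `σ·d ∈ dUU l` for `d ∈ dUU l`: `inl (σ·d) = inr σ · inl d · inr σ⁻¹ ∈ Π^tp_{X̲̲}`, then `hleft`.
[cite: MochizukiEtTh2009, Def 2.5 (i) p.39] -/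
theorem actχq_mem_dUU_of_clauses (σ : GQp p) {d : Gfp} (hd : d ∈ dUU l') : actχq p i j σ d ∈ dUU l' := by
  have hmem : (SemidirectProduct.inl (actχq p i j σ d) : PiTpχq p i j) ∈ C.Huu := by
    rw [SemidirectProduct.inl_aut, map_inv]
    exact C.Huu.mul_mem (C.Huu.mul_mem (hinr σ) (hinl d hd)) (C.Huu.inv_mem (hinr σ))
  simpa only [SemidirectProduct.left_inl] using hleft _ hmem

include hinl hinr hleft in
/-- **(ii) FROM (i).**  If a bi-continuous automorphism `Φ` of `Γ` satisfies (i) `inl (Φ d) = γ (inl d)` on `dUU l`, then it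
satisfies the twisted equivariance (ii) `inl (Φ (σ·g)) = γ(inr σ) · inl (Φ g) · γ(inr σ)⁻¹` for ALL `g ∈ Γ`: the two sides are
endomorphisms of `Γ` agreeing on `dUU l` (because `γ` is a homomorphism on `Π^tp_{X̲̲}`), the left one open; §1.
[cite: MochizukiEtTh2009, Prop 2.4 p.38] -/
theorem twisted_equivariance_of_extends (γ : ↥C.Huu ≃ₜ* ↥C.Huu) (Φ : Gfp ≃ₜ* Gfp)
    (hΦi : ∀ (d : Gfp) (hd : d ∈ dUU l'),
      (SemidirectProduct.inl (Φ d) : PiTpχq p i j) = ((γ ⟨SemidirectProduct.inl d, hinl d hd⟩ : C.Huu) : PiTpχq p i j))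
    (σ : GQp p) (g : Gfp) :
    (SemidirectProduct.inl (Φ (actχq p i j σ g)) : PiTpχq p i j) =
      ((γ ⟨SemidirectProduct.inr σ, hinr σ⟩ : C.Huu) : PiTpχq p i j) * SemidirectProduct.inl (Φ g) *
        (((γ ⟨SemidirectProduct.inr σ, hinr σ⟩ : C.Huu) : PiTpχq p i j))⁻¹ := by
  -- the value of `γ` on the Galois section, in coordinates
  set e : PiTpχq p i j := ((γ ⟨SemidirectProduct.inr σ, hinr σ⟩ : C.Huu) : PiTpχq p i j) with he
  -- the two endomorphisms of `Γ`
  let A : Gfp →* Gfp := Φ.toMulEquiv.toMonoidHom.comp (actχq p i j σ).toMonoidHom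
  let B : Gfp →* Gfp :=
    ((MulAut.conj e.left).toMonoidHom.comp (actχq p i j e.right).toMonoidHom).comp Φ.toMulEquiv.toMonoidHom
  have hA : ∀ x, A x = Φ (actχq p i j σ x) := fun _ => rfl
  have hB : ∀ y, (SemidirectProduct.inl (B y) : PiTpχq p i j) = e * SemidirectProduct.inl (Φ y) * e⁻¹ := fun y => by
    rw [conj_inl_eqq p i j e (Φ y)]
    rfl
  have hAopen : IsOpenMap A := by
    change IsOpenMap fun x => Φ (actχq p i j σ x)
    exact Φ.toHomeomorph.isOpenMap.comp (isOpenMap_actχq p i j σ)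
  -- they agree on `dUU l`
  have hAB : ∀ d ∈ dUU l', A d = B d := by
    intro d hd
    have hσd : actχq p i j σ d ∈ dUU l' := actχq_mem_dUU_of_clauses C hinl hinr hleft σ hd
    apply SemidirectProduct.inl_injective (φ := actχq p i j)
    rw [hA, hB, hΦi _ hσd]
    -- `inl (σ·d) = inr σ · inl d · inr σ⁻¹` inside `Π^tp_{X̲̲}`
    have hprod : (⟨SemidirectProduct.inl (actχq p i j σ d), hinl _ hσd⟩ : C.Huu) =
        ⟨SemidirectProduct.inr σ, hinr σ⟩ * ⟨SemidirectProduct.inl d, hinl d hd⟩ * (⟨SemidirectProduct.inr σ, hinr σ⟩)⁻¹ :=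
      Subtype.ext (by
        change SemidirectProduct.inl (actχq p i j σ d) =
          (SemidirectProduct.inr σ : PiTpχq p i j) * SemidirectProduct.inl d * (SemidirectProduct.inr σ)⁻¹
        rw [SemidirectProduct.inl_aut, map_inv])
    rw [hprod, map_mul, map_mul, map_inv, he, hΦi d hd]
    rfl
  -- hence everywhere
  have := monoidHom_apply_eq_of_eqOn_dUU l' hAopen hAB g
  rw [hA] at this
  rw [this, hB]

include hinl hinr hleft in
/-- ★ **`hextΔ(γ)` ⟺ THE GEOMETRIC PART OF `γ` EXTENDS TO `Aut_top(Γ)`** — clause (ii) of the reduction of record (p498683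
`hext_at_iff_exists_gfpAut'`) is redundant: at an `X̲̲`-choice with `Π^tp_{X̲̲} = dUU l ⋊ G_{ℚ_p}` over the stage-2 Tate model,
a bi-continuous automorphism `γ` of `Π^tp_{X̲̲}` extends to a `Δ^tp_X`-stabilising bi-continuous automorphism of `Π^tp_X`
IF AND ONLY IF there is a bi-continuous automorphism `Φ` of `Γ = F̂₂ ×_Ẑ ℤ` with `inl (Φ d) = γ (inl d)` for all `d ∈ dUU l`.
Neither direction of `hextΔ` is claimed. [cite: MochizukiEtTh2009, Prop 2.4 p.38] -/
theorem hext_at_iff_exists_gfpAut_extends (γ : ↥C.Huu ≃ₜ* ↥C.Huu) :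
    (∃ Γ : PiTpχq p i j ≃ₜ* PiTpχq p i j,
      (∀ h : C.Huu, Γ (h : PiTpχq p i j) = ((γ h : C.Huu) : PiTpχq p i j)) ∧
        (curveχq p i j).DeltaTemp.map Γ.toMulEquiv.toMonoidHom = (curveχq p i j).DeltaTemp) ↔
    ∃ Φ : Gfp ≃ₜ* Gfp, ∀ (d : Gfp) (hd : d ∈ dUU l'),
        (SemidirectProduct.inl (Φ d) : PiTpχq p i j) = ((γ ⟨SemidirectProduct.inl d, hinl d hd⟩ : C.Huu) : PiTpχq p i j) := by
  rw [hext_at_iff_exists_gfpAut' C hinl hinr hleft γ]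
  exact ⟨fun ⟨Φ, hi, _⟩ => ⟨Φ, hi⟩,
    fun ⟨Φ, hi⟩ => ⟨Φ, hi, twisted_equivariance_of_extends C hinl hinr hleft γ Φ hi⟩⟩

/-- **The geometric core AT THE CARRIER OF RECORD** `Π^tp_{X̲̲} = Huuχq p i j l hl` (the three membership clauses are theorems
there): for every `X̲̲`-choice `C` over `modelχq p i j` with `C.Huu = Huuχq p i j l hl`,
`hextΔ(γ) ⟺ ∃ Φ : Γ ≃ₜ* Γ, inl ∘ Φ = γ ∘ inl on dUU l`. [cite: MochizukiEtTh2009, Prop 2.4 p.38] -/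
theorem hext_at_iff_exists_gfpAut_extends_of_eq (l' : ℕ+) (hl' : Odd (l' : ℕ)) (hCH : C.Huu = Huuχq p i j l' hl')
    (γ : ↥C.Huu ≃ₜ* ↥C.Huu) :
    (∃ Γ : PiTpχq p i j ≃ₜ* PiTpχq p i j,
      (∀ h : C.Huu, Γ (h : PiTpχq p i j) = ((γ h : C.Huu) : PiTpχq p i j)) ∧
        (curveχq p i j).DeltaTemp.map Γ.toMulEquiv.toMonoidHom = (curveχq p i j).DeltaTemp) ↔
    ∃ Φ : Gfp ≃ₜ* Gfp, ∀ (d : Gfp) (hd : d ∈ dUU l'),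
        (SemidirectProduct.inl (Φ d) : PiTpχq p i j) =
          ((γ ⟨SemidirectProduct.inl d, hCH ▸ (inl_mem_Huuχq_iff p i j l' hl' d).2 hd⟩ : C.Huu) : PiTpχq p i j) :=
  hext_at_iff_exists_gfpAut_extends C (fun d hd => hCH ▸ (inl_mem_Huuχq_iff p i j l' hl' d).2 hd)
    (fun σ => hCH ▸ inr_mem_Huuχq p i j l' hl' σ)
    (fun h hh => ((mem_Huuχq_iff p i j l' hl' h).1 (hCH ▸ hh)).1 |> fun hx =>
      (mem_dUU_iff l' h.left).2 ⟨hx, ((mem_Huuχq_iff p i j l' hl' h).1 (hCH ▸ hh)).2⟩) γ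

/-! ## §3. Uniqueness of the geometric witness and of the extension -/

include hinl in
/-- **The witness `Φ` of (i) is UNIQUE**: two bi-continuous automorphisms of `Γ` that both restrict to the geometric part of `γ`
on `dUU l` coincide (§1). [cite: MochizukiSemiAnbd2006, Ex 3.10 p.45] -/
theorem gfpAut_extends_unique (γ : ↥C.Huu ≃ₜ* ↥C.Huu) (Φ₁ Φ₂ : Gfp ≃ₜ* Gfp)
    (h₁ : ∀ (d : Gfp) (hd : d ∈ dUU l'),
      (SemidirectProduct.inl (Φ₁ d) : PiTpχq p i j) = ((γ ⟨SemidirectProduct.inl d, hinl d hd⟩ : C.Huu) : PiTpχq p i j))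
    (h₂ : ∀ (d : Gfp) (hd : d ∈ dUU l'),
      (SemidirectProduct.inl (Φ₂ d) : PiTpχq p i j) = ((γ ⟨SemidirectProduct.inl d, hinl d hd⟩ : C.Huu) : PiTpχq p i j)) :
    Φ₁ = Φ₂ := by
  refine ContinuousMulEquiv.ext fun g => ?_
  exact monoidHom_apply_eq_of_eqOn_dUU l' (A := Φ₁.toMulEquiv.toMonoidHom) (B := Φ₂.toMulEquiv.toMonoidHom)
    Φ₁.toHomeomorph.isOpenMap
    (fun d hd => SemidirectProduct.inl_injective (φ := actχq p i j) (by
      change (SemidirectProduct.inl (Φ₁ d) : PiTpχq p i j) = SemidirectProduct.inl (Φ₂ d)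
      rw [h₁ d hd, h₂ d hd])) g

include hinl hinr hleft in
/-- **The `Δ^tp_X`-stabilising extension of `γ` is UNIQUE**: if `Γ₁`, `Γ₂` both extend `γ` and stabilise `Δ^tp_X`, then
`Γ₁ = Γ₂` (their geometric parts are witnesses of (i), equal by `gfpAut_extends_unique`; on the Galois section both equal `γ`).
[cite: MochizukiEtTh2009, Prop 2.4 p.38] -/
theorem hext_extension_unique (γ : ↥C.Huu ≃ₜ* ↥C.Huu) (Γ₁ Γ₂ : PiTpχq p i j ≃ₜ* PiTpχq p i j)
    (hΓ₁ : ∀ h : C.Huu, Γ₁ (h : PiTpχq p i j) = ((γ h : C.Huu) : PiTpχq p i j))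
    (hΔ₁ : (curveχq p i j).DeltaTemp.map Γ₁.toMulEquiv.toMonoidHom = (curveχq p i j).DeltaTemp)
    (hΓ₂ : ∀ h : C.Huu, Γ₂ (h : PiTpχq p i j) = ((γ h : C.Huu) : PiTpχq p i j))
    (hΔ₂ : (curveχq p i j).DeltaTemp.map Γ₂.toMulEquiv.toMonoidHom = (curveχq p i j).DeltaTemp) :
    Γ₁ = Γ₂ := by
  obtain ⟨Φ₁, _, hi₁, _⟩ := exists_gfpAut_of_hext_at C hinl hinr hleft γ ⟨Γ₁, hΓ₁, hΔ₁⟩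
  obtain ⟨Φ₂, _, hi₂, _⟩ := exists_gfpAut_of_hext_at C hinl hinr hleft γ ⟨Γ₂, hΓ₂, hΔ₂⟩
  -- the geometric parts of `Γ₁`, `Γ₂` are `Φ`'s with (i): recover them as restrictions
  have hF₁ := apply_inl_eq_inl_left_of_map_deltaTemp_eq Γ₁ hΔ₁
  have hF₂ := apply_inl_eq_inl_left_of_map_deltaTemp_eq Γ₂ hΔ₂
  -- the restrictions `g ↦ (Γ_k (inl g)).left` are endomorphisms of `Γ` agreeing with `Φ_k` on `dUU l`, hence equal to `Φ_k`
  have hres : ∀ (Γ' : PiTpχq p i j ≃ₜ* PiTpχq p i j)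
      (hF : ∀ g : Gfp, Γ' (SemidirectProduct.inl g) = SemidirectProduct.inl (Γ' (SemidirectProduct.inl g)).left)
      (hΓ' : ∀ h : C.Huu, Γ' (h : PiTpχq p i j) = ((γ h : C.Huu) : PiTpχq p i j)) (Φ : Gfp ≃ₜ* Gfp)
      (hi : ∀ (d : Gfp) (hd : d ∈ dUU l'),
        (SemidirectProduct.inl (Φ d) : PiTpχq p i j) = ((γ ⟨SemidirectProduct.inl d, hinl d hd⟩ : C.Huu) : PiTpχq p i j))
      (g : Gfp), Γ' (SemidirectProduct.inl g) = SemidirectProduct.inl (Φ g) := by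
    intro Γ' hF hΓ' Φ hi g
    let R : Gfp →* Gfp :=
      { toFun := fun g => (Γ' (SemidirectProduct.inl g)).left
        map_one' := by rw [map_one, map_one, SemidirectProduct.one_left]
        map_mul' := fun a b => by
          apply SemidirectProduct.inl_injective (φ := actχq p i j)
          rw [← hF, map_mul, map_mul, hF a, hF b, ← map_mul]
          simp only [SemidirectProduct.left_inl] }
    have hRΦ : ∀ d ∈ dUU l', Φ.toMulEquiv.toMonoidHom d = R d := fun d hd => by
      apply SemidirectProduct.inl_injective (φ := actχq p i j)
      change (SemidirectProduct.inl (Φ d) : PiTpχq p i j) = SemidirectProduct.inl (Γ' (SemidirectProduct.inl d)).left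
      rw [← hF, hi d hd, hΓ' ⟨_, hinl d hd⟩]
    have := monoidHom_apply_eq_of_eqOn_dUU l' (A := Φ.toMulEquiv.toMonoidHom) (B := R) Φ.toHomeomorph.isOpenMap hRΦ g
    rw [hF g]
    exact congrArg SemidirectProduct.inl this.symm
  have hΦ : Φ₁ = Φ₂ := gfpAut_extends_unique C hinl γ Φ₁ Φ₂ hi₁ hi₂
  refine ContinuousMulEquiv.ext fun x => ?_
  rw [← SemidirectProduct.inl_left_mul_inr_right x, map_mul, map_mul, hres Γ₁ hF₁ hΓ₁ Φ₁ hi₁, hres Γ₂ hF₂ hΓ₂ Φ₂ hi₂, hΦ,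
    hΓ₁ ⟨_, hinr x.right⟩, hΓ₂ ⟨_, hinr x.right⟩]

end Literature.AnabelianGeometry.EtaleTheta.SettingModel

end
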